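import Mathlib.Analysis.SpecialFunctions.Complex.LogDeriv
import Literature.Probability.RandomPlanarGeometry.ConformalRectangleProofs
import Literature.Analysis.Complex.InjectiveHolomorphic
import Literature.Topology.Euclidean.InvarianceOfDomain
import HarnessLib

/-!
# Images of marked Jordan domains under univalent maps (`ConformalRectangle.imageUnivalent`)

Topic `Literature/Probability/RandomPlanarGeometry` (definition item
`defn-ConformalRectangle.imageUnivalent`, for route `CardyExpCovariance` of `CardyFormulaZ2` —
`ExpGeneratesConformal`, non-vacuity of the hypotheses of `ExpCovariance` /
`TranslationCovariance` — and the conformal-covariance crux of `CardyViaSLE6`).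

Pushing a conformal rectangle `(Ω; A, B, C, D)` through a map `Φ` gives
`(Φ(Ω); Φ(A), Φ(B), Φ(C), Φ(D))` (Beffara 2008, §1.2 Def. 3, where the boundary extension of `Φ`
"is necessary for the above definition to make sense"; §2.1, proof of Prop. 4: "one can push the
whole picture forward through `φ_β`"). For the library's `JordanDomain` (the boundary Jordan curve
is part of the data) the image is again a Jordan domain as soon as `Φ` is continuous and
injective on the CLOSURE `Ω̄`: this is the implication (i) ⇒ (ii) of Carathéodory's theorem as
printed by Pommerenke (1992), Thm. 2.6 ("`f` has a continuous injective extension to `𝔻̄`" ⇒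
"`∂G` is a Jordan curve"), for a general Jordan domain in place of `𝔻`, openness of `Φ(Ω)` being
Brouwer's invariance of domain (`Literature.Topology.Euclidean.Brouwer.isOpen_image_of_injOn`).

* `JordanDomain.image`, `MarkedDomain.image D h hc hi` (`h` continuous and injective on
  `closure D.carrier`): carrier `h '' D.carrier`, loop `h ∘ D.boundary`, same marks, so
  `pt i = h (D.pt i)` and `arc i = h '' D.arc i`. These are exactly the hypotheses under which the
  route statements quantify over image rectangles `S` (`S.carrier = h '' R.carrier`,
  `S.pt i = h (R.pt i)`); such `S` exist (`ConformalRectangle.exists_image`).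
* `MarkedDomain.imageUnivalent D h hd hi`, `ConformalRectangle.imageUnivalent` — `h` holomorphic
  on `closure D` (`DifferentiableOn ℂ h (closure D.carrier)`, e.g. on an open neighbourhood of it)
  and injective there; definitionally an `image` (`imageUnivalent_eq_image`).
* `ConformalEquiv.ofInjOn` — an injective holomorphic map on an open set is a conformal
  equivalence onto its image (Fritzsche–Grauert 2002, Thm. I.8.5 / Cor. I.8.6).
* Transport (`MarkedDomain.IsUniformizing.image_data`, `.image`, `.imageUnivalent`): if `(φ, x)`
  uniformizes `R` then `(h ∘ φ, x)` uniformizes every such `S` (`h` holomorphic and injective on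
  `R.carrier`, continuous on the closure); hence the modulus is preserved
  (`ConformalRectangle.crossRatio_eq_of_image_data`, unconditional) and crossing limits transfer
  (`ConformalRectangle.hasCrossingLimit_iff_of_image_data`).
* Instances `MarkedDomain.translate`, `.affineImage` (similarities), `.expImage` (`exp` injective
  on the closure; `injOn_exp_of_abs_im_sub_lt`), `.logImage` (closure in `Complex.slitPlane`), and
  `ConformalRectangle.exists_translate` / `exists_exp_image` / `exists_conj_image` in the shape
  of the route hypotheses.

Tree: `JordanDomain`, `MarkedDomain`, `ConformalRectangle` (`PlanarDomains`); `ConformalEquiv`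
(`ConformalMap`); `IsUniformizing`, `crossRatio`, `HasCrossingLimit` (`ConformalRectangle`);
`exists_isUniformizing_holds`, `crossRatio_eq_of_isUniformizing_holds` (`ConformalRectangleProofs`).
`MarkedDomain.map` (`ChordalCurveFamily`) is the case of a global homeomorphism `ℂ ≃ₜ ℂ` (same
data fields); `MarkedDomain.conjugate` (`SmirnovReflection`) is the reflection. Not here: branches
of `log` / `z ^ α` on general simply connected domains avoiding `0` (compose `imageUnivalent`
with any such branch; the principal power `z ^ α = exp (α log z)`, `0 < α ≤ 1`, is
`logImage`, then `affineImage α 0`, then `expImage`, the last injectivity by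
`injOn_exp_of_abs_im_sub_lt` since `α log D̄` has imaginary width `< 2π`).

## References

* Ch. Pommerenke, *Boundary Behaviour of Conformal Maps*, Springer (1992), §2.3, Thm. 2.6 and
  Cor. 2.7 [PommerenkeBBCM1992].
* V. Beffara, *Is critical 2D percolation universal?*, Progr. Probab. 60 (2008) 31–58,
  arXiv:0708.3908, §1.2 Def. 3 and §2.1 Prop. 4 [Beffara2008Universal].
* K. Fritzsche, H. Grauert, *From Holomorphic Functions to Complex Manifolds*, GTM 213 (2002),
  Thm. I.8.5, Cor. I.8.6 [FritzscheGrauert2002].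
-/

noncomputable section

open Set Filter Topology Complex
open UpperHalfPlane (upperHalfPlaneSet isOpen_upperHalfPlaneSet)

namespace Literature.Probability.RandomPlanarGeometry

/-! ### Embeddings of the closure of a bounded open planar set -/

section Embedding

variable {h : ℂ → ℂ} {s : Set ℂ}

/-- For a bounded set `s` and `h` continuous on `closure s`, the closure of the image is the
image of the closure (`h '' closure s` is compact, hence closed). [folklore] -/
theorem closure_image_of_isBounded (hs : Bornology.IsBounded s)
    (hc : ContinuousOn h (closure s)) : closure (h '' s) = h '' closure s :=
  (closure_minimal (image_mono subset_closure)
    (hs.isCompact_closure.image_of_continuousOn hc).isClosed).antisymm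
    hc.image_closure

/-- **Invariance of domain** for a map continuous and injective on the closure of an open planar
set: the image of the open set is open (Brouwer; Tao 2014, Thm. 6.0.12, from
`Literature.Topology.Euclidean.Brouwer.isOpen_image_of_injOn`). [cite: Tao2014, Thm. 6.0.12] -/
theorem isOpen_image_of_injOn_closure (ho : IsOpen s) (hc : ContinuousOn h (closure s))
    (hi : InjOn h (closure s)) : IsOpen (h '' s) :=
  Literature.Topology.Euclidean.Brouwer.isOpen_image_of_injOn rfl ho (hc.mono subset_closure)
    (hi.mono subset_closure)

/-- For a bounded open set `s` and `h` continuous and injective on `closure s`, the frontier of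
the image is the image of the frontier: `∂(h s) = h(∂s)` (Pommerenke 1992, proof of Thm. 2.6,
"(i) ⇒ (ii)": `f(𝔻) = G` is disjoint from `f(𝕋) = ∂G`). [cite: PommerenkeBBCM1992, Thm. 2.6] -/
theorem frontier_image_of_isBounded (hs : Bornology.IsBounded s) (ho : IsOpen s)
    (hc : ContinuousOn h (closure s)) (hi : InjOn h (closure s)) :
    frontier (h '' s) = h '' frontier s := by
  rw [(isOpen_image_of_injOn_closure ho hc hi).frontier_eq, ho.frontier_eq,
    closure_image_of_isBounded hs hc, hi.image_sdiff_subset subset_closure]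

/-- `exp` is injective on any set of imaginary width `< 2π` (two preimages of the same value
differ by a multiple of `2πi`). Discharges the hypothesis `InjOn exp (closure R.carrier)` of
`MarkedDomain.expImage` for thin rectangles. [folklore] -/
theorem injOn_exp_of_abs_im_sub_lt (hs : ∀ z ∈ s, ∀ w ∈ s, |z.im - w.im| < 2 * Real.pi) :
    InjOn exp s := by
  intro z hz w hw hzw
  obtain ⟨n, hn⟩ := Complex.exp_eq_exp_iff_exists_int.1 hzw
  have him : z.im - w.im = n * (2 * Real.pi) := by
    have := congrArg Complex.im hn
    simp only [add_im, mul_im, intCast_re, mul_re, re_ofNat, ofReal_re, im_ofNat, ofReal_im,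
      mul_zero, sub_zero, I_im, mul_one, intCast_im, I_re, zero_mul, add_zero] at this
    linarith
  have habs := hs z hz w hw
  rw [him, abs_mul, abs_of_pos Real.two_pi_pos] at habs
  have hn1 : |(n : ℝ)| < 1 := (mul_lt_iff_lt_one_left Real.two_pi_pos).1 habs
  have hn0 : n = 0 := Int.abs_lt_one_iff.1 (by exact_mod_cast hn1)
  subst hn0
  simpa using hn

end Embedding

/-! ### The image of a Jordan domain under an embedding of its closure -/

namespace JordanDomain

/-- **Image of a Jordan domain** under a map `h : ℂ → ℂ` continuous and injective on
`closure D`: the Jordan domain with carrier `h '' D` and boundary loop `h ∘ ∂D`. It is open by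
invariance of domain, bounded and connected as a continuous image, and its frontier is the image
Jordan curve `h(∂D)` — Carathéodory's theorem, Pommerenke (1992), Thm. 2.6, implication
(i) ⇒ (ii) ("`f` has a continuous injective extension to `𝔻̄`" ⇒ "`∂G` is a Jordan curve"), with a
general Jordan domain in place of `𝔻`. [cite: PommerenkeBBCM1992, Thm. 2.6] -/
def image (D : JordanDomain) (h : ℂ → ℂ) (hc : ContinuousOn h (closure D.carrier))
    (hi : InjOn h (closure D.carrier)) : JordanDomain where
  carrier := h '' D.carrier
  boundary := h ∘ D.boundary
  isOpen := isOpen_image_of_injOn_closure D.isOpen hc hi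
  isBounded := (D.isBounded.isCompact_closure.image_of_continuousOn hc).isBounded.subset
    (image_mono subset_closure)
  isConnected := D.isConnected.image h (hc.mono subset_closure)
  continuous_boundary := hc.comp_continuous D.continuous_boundary fun t ↦
    frontier_subset_closure (D.boundary_mem_frontier t)
  periodic_boundary := D.periodic_boundary.comp h
  injOn_boundary := hi.comp D.injOn_boundary fun t _ ↦
    frontier_subset_closure (D.boundary_mem_frontier t)
  range_boundary := by
    rw [range_comp, D.range_boundary, frontier_image_of_isBounded D.isBounded D.isOpen hc hi]

variable (D : JordanDomain) (h : ℂ → ℂ) (hc : ContinuousOn h (closure D.carrier))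
  (hi : InjOn h (closure D.carrier))

/-- The carrier of the image domain is the image of the carrier. [folklore] -/
@[simp] theorem carrier_image : (D.image h hc hi).carrier = h '' D.carrier := rfl

/-- The boundary loop of the image domain is `h ∘ ∂D`. [folklore] -/
@[simp] theorem boundary_image : (D.image h hc hi).boundary = h ∘ D.boundary := rfl

/-- The closure of the image domain is the image of the closure. [folklore] -/
theorem closure_carrier_image : closure (D.image h hc hi).carrier = h '' closure D.carrier :=
  closure_image_of_isBounded D.isBounded hc

/-- The frontier of the image domain is the image of the frontier
(Pommerenke 1992, Thm. 2.6). [cite: PommerenkeBBCM1992, Thm. 2.6] -/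
theorem frontier_carrier_image : frontier (D.image h hc hi).carrier = h '' frontier D.carrier :=
  frontier_image_of_isBounded D.isBounded D.isOpen hc hi

/-- `h` restricted to `closure D` is a homeomorphism onto the closure of the image: its inverse
`Function.invFunOn h (closure D)` is continuous there (continuous bijection of a compact set).
[folklore] -/
theorem continuousOn_invFunOn_closure_image :
    ContinuousOn (Function.invFunOn h (closure D.carrier)) (closure (D.image h hc hi).carrier) := by
  rw [closure_carrier_image]
  exact continuousOn_invFunOn_of_isCompact D.isBounded.isCompact_closure hc hi.bijOn_image

end JordanDomain

/-! ### Marked domains and conformal rectangles -/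

namespace MarkedDomain

variable {n : ℕ}

/-- **Image of a marked domain** `(D; x₁, …, xₙ) ↦ (h D; h x₁, …, h xₙ)` under a map continuous and
injective on `closure D`: the image Jordan domain with the same boundary parameters (Beffara
2008, §1.2 Def. 3: `(Φ(Ω), Φ(A), Φ(B), Φ(C), Φ(D))`). [cite: Beffara2008Universal, §1.2 Definition 3] -/
def image (D : MarkedDomain n) (h : ℂ → ℂ) (hc : ContinuousOn h (closure D.carrier))
    (hi : InjOn h (closure D.carrier)) : MarkedDomain n where
  toJordanDomain := D.toJordanDomain.image h hc hi
  mark := D.mark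
  strictMono_mark := D.strictMono_mark
  mark_mem := D.mark_mem

section image

variable (D : MarkedDomain n) (h : ℂ → ℂ) (hc : ContinuousOn h (closure D.carrier))
  (hi : InjOn h (closure D.carrier))

/-- The carrier of the image marked domain. [folklore] -/
@[simp] theorem carrier_image : (D.image h hc hi).carrier = h '' D.carrier := rfl

/-- The boundary loop of the image marked domain. [folklore] -/
@[simp] theorem boundary_image : (D.image h hc hi).boundary = h ∘ D.boundary := rfl

/-- The image keeps the boundary parameters of the marked points. [folklore] -/
@[simp] theorem mark_image : (D.image h hc hi).mark = D.mark := rfl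

/-- The image keeps the cyclic successor parameters. [folklore] -/
@[simp] theorem nextMark_image (i : Fin n) : (D.image h hc hi).nextMark i = D.nextMark i := rfl

/-- The marked points of the image are the images of the marked points
(Beffara 2008, §1.2 Def. 3). [cite: Beffara2008Universal, §1.2 Definition 3] -/
@[simp] theorem pt_image (i : Fin n) : (D.image h hc hi).pt i = h (D.pt i) := rfl

/-- The boundary arcs of the image are the images of the arcs. [folklore] -/
@[simp] theorem arc_image (i : Fin n) : (D.image h hc hi).arc i = h '' D.arc i :=
  image_comp h D.boundary _

/-- The closure of the image marked domain is the image of the closure. [folklore] -/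
theorem closure_carrier_image : closure (D.image h hc hi).carrier = h '' closure D.carrier :=
  D.toJordanDomain.closure_carrier_image h hc hi

/-- The frontier of the image marked domain is the image of the frontier. [folklore] -/
theorem frontier_carrier_image : frontier (D.image h hc hi).carrier = h '' frontier D.carrier :=
  D.toJordanDomain.frontier_carrier_image h hc hi

/-- Taking the image commutes with restricting the marks. [folklore] -/
theorem restrictMarks_image {m : ℕ} (f : Fin m ↪o Fin n) :
    (D.image h hc hi).restrictMarks f = (D.restrictMarks f).image h hc hi := rfl

/-- Taking the image commutes with passing to a chord `(D; pt i, pt j)`. [folklore] -/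
theorem chord_image (i j : Fin n) (hij : i < j) :
    (D.image h hc hi).chord i j hij = (D.chord i j hij).image h hc hi := rfl

end image

/-- **Image of a marked domain under a univalent map**: for `h` holomorphic on `closure D`
(`DifferentiableOn ℂ h (closure D.carrier)`) and injective there, the marked Jordan domain
`(h D; h x₁, …, h xₙ)` (Beffara 2008, §1.2 Def. 3 and §2.1, proof of Prop. 4: "push the whole
picture forward through `φ_β`"). For `h` holomorphic and injective on an open `U ⊇ closure D`
(`hd : DifferentiableOn ℂ h U`, `hi : InjOn h U`, `hU : closure D.carrier ⊆ U`) use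
`D.imageUnivalent h (hd.mono hU) (hi.mono hU)`; for an entire `h` (translations, similarities,
`exp`) `h.differentiableOn`. It is `MarkedDomain.image` of the continuous map `h`
(`imageUnivalent_eq_image`). [cite: Beffara2008Universal, §1.2 Definition 3] -/
def imageUnivalent (D : MarkedDomain n) (h : ℂ → ℂ)
    (hd : DifferentiableOn ℂ h (closure D.carrier)) (hi : InjOn h (closure D.carrier)) :
    MarkedDomain n :=
  D.image h hd.continuousOn hi

section imageUnivalent

variable (D : MarkedDomain n) (h : ℂ → ℂ) (hd : DifferentiableOn ℂ h (closure D.carrier))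
  (hi : InjOn h (closure D.carrier))

/-- `imageUnivalent` is the topological `image` of the (continuous) univalent map. [folklore] -/
theorem imageUnivalent_eq_image : D.imageUnivalent h hd hi = D.image h hd.continuousOn hi := rfl

/-- The carrier of the univalent image is `h '' D`. [folklore] -/
@[simp] theorem carrier_imageUnivalent : (D.imageUnivalent h hd hi).carrier = h '' D.carrier := rfl

/-- The marked points of the univalent image are `h (D.pt i)`. [folklore] -/
@[simp] theorem pt_imageUnivalent (i : Fin n) : (D.imageUnivalent h hd hi).pt i = h (D.pt i) :=
  rfl

/-- The boundary arcs of the univalent image are `h '' D.arc i`. [folklore] -/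
@[simp] theorem arc_imageUnivalent (i : Fin n) :
    (D.imageUnivalent h hd hi).arc i = h '' D.arc i :=
  D.arc_image h hd.continuousOn hi i

/-- The closure of the univalent image is `h '' closure D`. [folklore] -/
theorem closure_carrier_imageUnivalent :
    closure (D.imageUnivalent h hd hi).carrier = h '' closure D.carrier :=
  D.closure_carrier_image h hd.continuousOn hi

end imageUnivalent

end MarkedDomain

/-- **Image of a conformal rectangle under a univalent map** `(Ω; a, b, c, d) ↦ (h Ω; h a, …, h d)`,
for `h` holomorphic on `closure Ω` and injective there (Beffara 2008, §1.2 Def. 3); the case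
`n = 4` of `MarkedDomain.imageUnivalent`. [cite: Beffara2008Universal, §1.2 Definition 3] -/
abbrev ConformalRectangle.imageUnivalent (R : ConformalRectangle) (h : ℂ → ℂ)
    (hd : DifferentiableOn ℂ h (closure R.carrier)) (hi : InjOn h (closure R.carrier)) :
    ConformalRectangle :=
  MarkedDomain.imageUnivalent R h hd hi

/-- **Image of a conformal rectangle under an embedding of its closure** (`h` continuous and
injective on `closure Ω`); the case `n = 4` of `MarkedDomain.image`. [cite: Beffara2008Universal, §1.2 Definition 3] -/
abbrev ConformalRectangle.image (R : ConformalRectangle) (h : ℂ → ℂ)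
    (hc : ContinuousOn h (closure R.carrier)) (hi : InjOn h (closure R.carrier)) :
    ConformalRectangle :=
  MarkedDomain.image R h hc hi

/-! ### Univalent maps as conformal equivalences; transport of uniformizing data -/

namespace ConformalEquiv

variable {U V : Set ℂ}

/-- An injective holomorphic map `h` on an open set `U` is a **conformal equivalence onto its
image** `V = h '' U`: the inverse `Function.invFunOn h U` is holomorphic on `V` because `h' ≠ 0`
on `U` (Fritzsche–Grauert 2002, Thm. I.8.5 / Cor. I.8.6, `SCV.deriv_ne_zero_of_injOn` and
`Complex.differentiableOn_invFunOn_image`). [cite: FritzscheGrauert2002, Ch. I §8 Cor. 8.6] -/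
def ofInjOn (h : ℂ → ℂ) (hU : IsOpen U) (hd : DifferentiableOn ℂ h U) (hi : InjOn h U)
    (hV : h '' U = V) : ConformalEquiv U V where
  toFun := h
  invFun := Function.invFunOn h U
  source := U
  target := V
  map_source' z hz := hV ▸ mem_image_of_mem h hz
  map_target' w hw := hi.bijOn_image.surjOn.mapsTo_invFunOn (hV.symm ▸ hw)
  left_inv' z hz := hi.leftInvOn_invFunOn hz
  right_inv' w hw := Function.invFunOn_eq (hV.symm ▸ hw : w ∈ h '' U)
  source_eq := rfl
  target_eq := rfl
  differentiableOn := hd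
  differentiableOn_symm := by
    rw [← hV]
    exact Complex.differentiableOn_invFunOn_image hU hd hi fun _ hz ↦
      Literature.Analysis.Complex.SCV.deriv_ne_zero_of_injOn hd hU hi hz

/-- `ofInjOn h …` acts as `h`. [folklore] -/
@[simp] theorem ofInjOn_apply (h : ℂ → ℂ) (hU : IsOpen U) (hd : DifferentiableOn ℂ h U)
    (hi : InjOn h U) (hV : h '' U = V) (z : ℂ) : ofInjOn h hU hd hi hV z = h z := rfl

/-- The inverse of `ofInjOn h …` acts as `Function.invFunOn h U`. [folklore] -/
@[simp] theorem ofInjOn_symm_apply (h : ℂ → ℂ) (hU : IsOpen U) (hd : DifferentiableOn ℂ h U)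
    (hi : InjOn h U) (hV : h '' U = V) (w : ℂ) :
    (ofInjOn h hU hd hi hV).symm w = Function.invFunOn h U w := rfl

end ConformalEquiv

namespace MarkedDomain

variable {n : ℕ}

/-- **Transport of uniformizing data through a univalent map.** Let `h` be holomorphic and
injective on `R.carrier` and continuous on its closure, and let `S` be ANY marked domain realising
the image: `S.carrier = h '' R.carrier`, `S.pt i = h (R.pt i)`. If `(φ, x)` uniformizes `R` then
`(h ∘ φ, x)` uniformizes `S` (same real boundary preimages): `h ∘ φ : ℍₒ → S` is a conformal
equivalence and `h (φ z) → h (R.pt i) = S.pt i` as `z → x i`. This is the step "conformal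
invariance ⇔ `f` only depends on the modulus" of Beffara (2008), §1.2 Def. 3.
[cite: Beffara2008Universal, §1.2 Definition 3] -/
theorem IsUniformizing.image_data {R S : MarkedDomain n} {h : ℂ → ℂ}
    (hd : DifferentiableOn ℂ h R.carrier) (hi : InjOn h R.carrier)
    (hc : ContinuousOn h (closure R.carrier)) (hS : S.carrier = h '' R.carrier)
    (hpt : ∀ i, S.pt i = h (R.pt i)) {φ : ConformalEquiv upperHalfPlaneSet R.carrier}
    {x : Fin n → ℝ} (hφ : R.IsUniformizing φ x) :
    S.IsUniformizing (φ.trans (ConformalEquiv.ofInjOn h R.isOpen hd hi hS.symm)) x := by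
  refine ⟨hφ.1, fun i ↦ ?_⟩
  have h1 : Tendsto φ (𝓝[upperHalfPlaneSet] (x i)) (𝓝[R.carrier] (R.pt i)) :=
    tendsto_nhdsWithin_iff.2 ⟨hφ.2 i, eventually_mem_nhdsWithin.mono fun z hz ↦ φ.mapsTo hz⟩
  have h2 : Tendsto h (𝓝[R.carrier] (R.pt i)) (𝓝 (h (R.pt i))) :=
    ((hc (R.pt i) (frontier_subset_closure (R.pt_mem_frontier i))).mono subset_closure).tendsto
  rw [ConformalEquiv.HasBoundaryValue, hpt i]
  exact h2.comp h1

/-- Transport of uniformizing data to `MarkedDomain.image` (for `h` moreover holomorphic on the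
open carrier). [cite: Beffara2008Universal, §1.2 Definition 3] -/
theorem IsUniformizing.image {D : MarkedDomain n} {h : ℂ → ℂ}
    (hc : ContinuousOn h (closure D.carrier)) (hi : InjOn h (closure D.carrier))
    (hd : DifferentiableOn ℂ h D.carrier) {φ : ConformalEquiv upperHalfPlaneSet D.carrier}
    {x : Fin n → ℝ} (hφ : D.IsUniformizing φ x) :
    (D.image h hc hi).IsUniformizing
      (φ.trans (ConformalEquiv.ofInjOn h D.isOpen hd (hi.mono subset_closure) rfl)) x :=
  hφ.image_data hd (hi.mono subset_closure) hc rfl fun _ ↦ rfl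

/-- Transport of uniformizing data to `MarkedDomain.imageUnivalent`: if `(φ, x)` uniformizes `D`
then `(h ∘ φ, x)` uniformizes `h D`. [cite: Beffara2008Universal, §1.2 Definition 3] -/
theorem IsUniformizing.imageUnivalent {D : MarkedDomain n} {h : ℂ → ℂ}
    (hd : DifferentiableOn ℂ h (closure D.carrier)) (hi : InjOn h (closure D.carrier))
    {φ : ConformalEquiv upperHalfPlaneSet D.carrier} {x : Fin n → ℝ} (hφ : D.IsUniformizing φ x) :
    (D.imageUnivalent h hd hi).IsUniformizing (φ.trans (ConformalEquiv.ofInjOn h D.isOpen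
      (hd.mono subset_closure) (hi.mono subset_closure) rfl)) x :=
  hφ.image hd.continuousOn hi (hd.mono subset_closure)

end MarkedDomain

namespace ConformalRectangle

/-- **The conformal modulus is preserved by univalent maps.** With `h`, `R`, `S` as in
`IsUniformizing.image_data` (`S.carrier = h '' R.carrier`, `S.pt i = h (R.pt i)`), any
uniformizing data `(φ, x)` of `R` and `(ψ, y)` of `S` have the same cross-ratio. Unconditional:
transport plus `crossRatio_eq_of_isUniformizing_holds` (Pommerenke 1992, Cor. 2.7).
[cite: PommerenkeBBCM1992, Cor. 2.7] -/
theorem crossRatio_eq_of_image_data {R S : ConformalRectangle} {h : ℂ → ℂ}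
    (hd : DifferentiableOn ℂ h R.carrier) (hi : InjOn h R.carrier)
    (hc : ContinuousOn h (closure R.carrier)) (hS : S.carrier = h '' R.carrier)
    (hpt : ∀ i, S.pt i = h (R.pt i)) {φ : ConformalEquiv upperHalfPlaneSet R.carrier}
    {x : Fin 4 → ℝ} (hφ : R.IsUniformizing φ x) {ψ : ConformalEquiv upperHalfPlaneSet S.carrier}
    {y : Fin 4 → ℝ} (hψ : S.IsUniformizing ψ y) : crossRatio x = crossRatio y :=
  crossRatio_eq_of_isUniformizing_holds (hφ.image_data hd hi hc hS hpt) hψ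

/-- Crossing limits transfer from an image rectangle `S` to `R` along the same family `p`:
if `p δ → F η_S` then `p δ → F η_R` (the moduli agree). [folklore] -/
theorem HasCrossingLimit.of_image_data {R S : ConformalRectangle} {h : ℂ → ℂ}
    (hd : DifferentiableOn ℂ h R.carrier) (hi : InjOn h R.carrier)
    (hc : ContinuousOn h (closure R.carrier)) (hS : S.carrier = h '' R.carrier)
    (hpt : ∀ i, S.pt i = h (R.pt i)) {p F : ℝ → ℝ} (hlim : S.HasCrossingLimit p F) :
    R.HasCrossingLimit p F :=
  fun _ x hφ ↦ hlim _ x (hφ.image_data hd hi hc hS hpt)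

/-- Crossing limits of `R` and of an image rectangle `S` along the same family `p` are
equivalent (moduli agree; uniformizing data exist by `exists_isUniformizing_holds`). [folklore] -/
theorem hasCrossingLimit_iff_of_image_data {R S : ConformalRectangle} {h : ℂ → ℂ}
    (hd : DifferentiableOn ℂ h R.carrier) (hi : InjOn h R.carrier)
    (hc : ContinuousOn h (closure R.carrier)) (hS : S.carrier = h '' R.carrier)
    (hpt : ∀ i, S.pt i = h (R.pt i)) {p F : ℝ → ℝ} :
    S.HasCrossingLimit p F ↔ R.HasCrossingLimit p F := by
  refine ⟨HasCrossingLimit.of_image_data hd hi hc hS hpt, fun hR ψ y hψ ↦ ?_⟩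
  obtain ⟨φ, x, hφ⟩ := MarkedDomain.exists_isUniformizing_holds R
  rw [← crossRatio_eq_of_image_data hd hi hc hS hpt hφ hψ]
  exact hR φ x hφ

/-- Image rectangles exist in the shape quantified over by route statements: for `h` continuous
and injective on `closure R` there is a conformal rectangle `S` with `S.carrier = h '' R.carrier`
and `S.pt i = h (R.pt i)` (namely `R.image h hc hi`). [folklore] -/
theorem exists_image (R : ConformalRectangle) (h : ℂ → ℂ) (hc : ContinuousOn h (closure R.carrier))
    (hi : InjOn h (closure R.carrier)) :
    ∃ S : ConformalRectangle, S.carrier = h '' R.carrier ∧ ∀ i, S.pt i = h (R.pt i) :=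
  ⟨R.image h hc hi, rfl, fun _ ↦ rfl⟩

end ConformalRectangle

/-! ### Instances: translations, similarities, `exp`, `log`, conjugation -/

namespace MarkedDomain

variable {n : ℕ} (D : MarkedDomain n)

/-- The **translate** `D + a = (D + a; x₁ + a, …)` of a marked domain. [folklore] -/
def translate (a : ℂ) : MarkedDomain n :=
  D.imageUnivalent (· + a) (differentiable_id.add_const a).differentiableOn
    (add_left_injective a).injOn

/-- The carrier of the translate. [folklore] -/
@[simp] theorem carrier_translate (a : ℂ) : (D.translate a).carrier = (· + a) '' D.carrier := rfl

/-- The marked points of the translate. [folklore] -/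
@[simp] theorem pt_translate (a : ℂ) (i : Fin n) : (D.translate a).pt i = D.pt i + a := rfl

/-- The image `c D + w` of a marked domain under the orientation-preserving **similarity**
`z ↦ c z + w`, `c ≠ 0` (cf. `MarkedDomain.map (similarity c hc w)` of `ChordalCurveFamily`, the same
data). [folklore] -/
def affineImage (c w : ℂ) (hc : c ≠ 0) : MarkedDomain n :=
  D.imageUnivalent (fun z ↦ c * z + w) ((differentiable_id.const_mul c).add_const w).differentiableOn
    fun _ _ _ _ hzy ↦ mul_left_cancel₀ hc (add_right_cancel hzy)

/-- The carrier of the similar image. [folklore] -/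
@[simp] theorem carrier_affineImage (c w : ℂ) (hc : c ≠ 0) :
    (D.affineImage c w hc).carrier = (fun z ↦ c * z + w) '' D.carrier := rfl

/-- The marked points of the similar image. [folklore] -/
@[simp] theorem pt_affineImage (c w : ℂ) (hc : c ≠ 0) (i : Fin n) :
    (D.affineImage c w hc).pt i = c * D.pt i + w := rfl

/-- The image `exp D` of a marked domain on whose closure `exp` is injective (e.g. `D̄` of
imaginary width `< 2π`, `injOn_exp_of_abs_im_sub_lt`); the map `R ↦ exp R` of the
exp-covariance statements. [folklore] -/
def expImage (hinj : InjOn exp (closure D.carrier)) : MarkedDomain n :=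
  D.imageUnivalent exp Complex.differentiable_exp.differentiableOn hinj

/-- The carrier of `exp D`. [folklore] -/
@[simp] theorem carrier_expImage (hinj : InjOn exp (closure D.carrier)) :
    (D.expImage hinj).carrier = exp '' D.carrier := rfl

/-- The marked points of `exp D`. [folklore] -/
@[simp] theorem pt_expImage (hinj : InjOn exp (closure D.carrier)) (i : Fin n) :
    (D.expImage hinj).pt i = exp (D.pt i) := rfl

/-- The image `log D` of a marked domain whose closure lies in the slit plane `ℂ ∖ (-∞, 0]`, under
the principal branch `Complex.log` (holomorphic on the slit plane, injective on `ℂ ∖ {0}` as a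
right inverse of `exp`). [folklore] -/
def logImage (hD : closure D.carrier ⊆ slitPlane) : MarkedDomain n :=
  D.imageUnivalent log
    (fun _ hz ↦ (Complex.hasStrictDerivAt_log (hD hz)).hasDerivAt.differentiableAt
      |>.differentiableWithinAt)
    fun z hz w hw hzw ↦ by
      rw [← Complex.exp_log (slitPlane_ne_zero (hD hz)), ← Complex.exp_log (slitPlane_ne_zero (hD hw)),
        hzw]

/-- The carrier of `log D`. [folklore] -/
@[simp] theorem carrier_logImage (hD : closure D.carrier ⊆ slitPlane) :
    (D.logImage hD).carrier = log '' D.carrier := rfl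

/-- The marked points of `log D`. [folklore] -/
@[simp] theorem pt_logImage (hD : closure D.carrier ⊆ slitPlane) (i : Fin n) :
    (D.logImage hD).pt i = log (D.pt i) := rfl

end MarkedDomain

namespace ConformalRectangle

/-- Translates exist in the shape of the hypotheses of translation covariance:
`S.carrier = (· + a) '' R.carrier`, `S.pt i = R.pt i + a`. [folklore] -/
theorem exists_translate (R : ConformalRectangle) (a : ℂ) :
    ∃ S : ConformalRectangle, S.carrier = (fun z ↦ z + a) '' R.carrier ∧ ∀ i, S.pt i = R.pt i + a :=
  ⟨MarkedDomain.translate R a, rfl, fun _ ↦ rfl⟩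

/-- `exp`-images exist in the shape of the hypotheses of exp-covariance: if `exp` is injective on
`closure R` there is `S` with `S.carrier = exp '' R.carrier`, `S.pt i = exp (R.pt i)`. [folklore] -/
theorem exists_exp_image (R : ConformalRectangle) (hinj : InjOn exp (closure R.carrier)) :
    ∃ S : ConformalRectangle, S.carrier = exp '' R.carrier ∧ ∀ i, S.pt i = exp (R.pt i) :=
  ⟨MarkedDomain.expImage R hinj, rfl, fun _ ↦ rfl⟩

/-- Conjugate rectangles exist in the shape of the hypotheses of reflection symmetry:
`S.carrier = conj '' R.carrier`, `S.pt i = conj (R.pt i)` (the topological `image` under the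
anti-holomorphic homeomorphism `conj`; cf. `MarkedDomain.conjugate`). [folklore] -/
theorem exists_conj_image (R : ConformalRectangle) :
    ∃ S : ConformalRectangle, S.carrier = (starRingEnd ℂ) '' R.carrier ∧
      ∀ i, S.pt i = (starRingEnd ℂ) (R.pt i) :=
  ⟨R.image (starRingEnd ℂ) Complex.continuous_conj.continuousOn
    (RingHom.injective (starRingEnd ℂ)).injOn, rfl, fun _ ↦ rfl⟩

end ConformalRectangle

end Literature.Probability.RandomPlanarGeometry
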